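import Mathlib
import Literature.Analysis.FluidPDE.GaussianVortexPlanar
import Literature.Analysis.FluidPDE.GaussianVortexPlanarProofs
import Literature.Analysis.FluidPDE.BiotSavart2DSymmetry
import Summits.AnomalousDissipation.AnomalousDissipation.Theorems.MarginalStabilityChainStretchedVortexRowsStubCoreInverseTools
import Summits.AnomalousDissipation.AnomalousDissipation.Theorems.MarginalStabilityChainStretchedVortexRowsStubCoreRotationLocalSkew
import Summits.AnomalousDissipation.AnomalousDissipation.Theorems.MarginalStabilityChainStretchedVortexRowsStubBiotSavartFarField
import Summits.AnomalousDissipation.AnomalousDissipation.Theorems.MarginalStabilityChainStretchedVortexRowsStubWeakDivFreeGaussClass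
import HarnessLib

/-!
# Helper toward stub `stub_coreInverse` of the line `braid-closed-large-circulation-gluing`
# (crux stmt-AnomalousDissipation-3009, `MarginalStabilityChain.StretchedVortexRows`):
# the transport part of the background pairing is a potential term

For `w = G u` (`u ∈ C¹`, `u, Du` bounded) and the background velocity `u_B = K∗w_B` of a Gaussian-class density `w_B`,
the transport half of `⟨Λ_B w, w⟩_{L²(G⁻¹)}` is
  `∫ G⁻¹ w ⟪u_B, ∇w⟫ = −¼ ∫ G u² (ξ·u_B)`                     (`lamB_transport_pairing_identity`):
pointwise `G⁻¹w⟪u_B,∇w⟫ = ½⟪u_B, ∇(Gu²)⟫ − ¼Gu²(ξ·u_B)` (`∇G = −(ξ/2)G`), and `∫⟪u_B, ∇(Gu²)⟫ = 0` because `K∗w_B`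
is weakly divergence-free against Gaussian-class test functions (`integral_inner_biotSavart2D_gradient_eq_zero_of_gaussClass`).
The right-hand side is a POTENTIAL term (no derivative of `w`) whose radial↔radial block vanishes (`ξ·u_B` has zero circular
means), which is how `lamB_pairing_w_bound` controls it by the angular energy `Θ`.
-/

set_option linter.dupNamespace false

noncomputable section

open scoped RealInnerProductSpace Topology
open MeasureTheory WithLp Function Metric Filter Set

namespace Summit.AnomalousDissipation.AnomalousDissipation.Theorems.MarginalStabilityChainStretchedVortexRows

open Literature.Analysis.FluidPDE

/-- **Transport part of the background pairing**: `∫ G⁻¹ w ⟪K∗w_B, ∇w⟫ = −¼ ∫ G u² ⟪ξ, K∗w_B⟫` for `w = Gu`. [folklore] -/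
theorem lamB_transport_pairing_identity :
    ∀ (k : ℕ) (C_B : ℝ) (wB u : EuclideanSpace ℝ (Fin 2) → ℝ), Continuous wB →
      (∀ ξ, |wB ξ| ≤ C_B * (1 + ‖ξ‖) ^ k * gaussVortexProfile ξ) →
      ContDiff ℝ 1 u → (∃ M : ℝ, ∀ ξ, |u ξ| ≤ M ∧ ‖fderiv ℝ u ξ‖ ≤ M) →
      ∫ ξ, (gaussVortexProfile ξ)⁻¹ * ⟪biotSavart2D wB ξ, gradient (fun η => gaussVortexProfile η * u η) ξ⟫ *
          (gaussVortexProfile ξ * u ξ) =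
        -(1 / 4) * ∫ ξ, gaussVortexProfile ξ * u ξ ^ 2 * ⟪ξ, biotSavart2D wB ξ⟫ := by
  intro k C_B wB u hwBc hwBb hu hM
  obtain ⟨M, hM⟩ := hM
  have hM0 : 0 ≤ M := (abs_nonneg _).trans (hM 0).1
  have hGpos : ∀ ξ : EuclideanSpace ℝ (Fin 2), 0 < gaussVortexProfile ξ := gaussVortexProfile_pos
  have hGne : ∀ ξ : EuclideanSpace ℝ (Fin 2), gaussVortexProfile ξ ≠ 0 := fun ξ => (hGpos ξ).ne'
  have hud : ∀ ξ, DifferentiableAt ℝ u ξ := fun ξ => hu.differentiable one_ne_zero ξ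
  have hGd : ∀ ξ, DifferentiableAt ℝ gaussVortexProfile ξ := fun ξ =>
    (contDiff_gaussVortexProfile (n := 1)).differentiable one_ne_zero ξ
  -- `w_B` is bounded and integrable; its velocity `b = K∗w_B` is bounded
  obtain ⟨Bk, hBk0, hBk⟩ := exists_bound_one_add_norm_pow_mul_gaussVortexProfile k
  have hCB : 0 ≤ C_B ∨ ∀ ξ, wB ξ = 0 := by
    by_cases h : 0 ≤ C_B
    · exact Or.inl h
    · refine Or.inr fun ξ => ?_
      have := hwBb ξ
      have hneg : C_B * (1 + ‖ξ‖) ^ k * gaussVortexProfile ξ ≤ 0 := by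
        have : 0 ≤ (1 + ‖ξ‖) ^ k * gaussVortexProfile ξ := by positivity [hGpos ξ]
        nlinarith
      exact abs_eq_zero.1 (le_antisymm (this.trans hneg) (abs_nonneg _))
  have hwBabs : ∀ ξ, |wB ξ| ≤ |C_B| * Bk := by
    intro ξ
    calc |wB ξ| ≤ C_B * (1 + ‖ξ‖) ^ k * gaussVortexProfile ξ := hwBb ξ
      _ ≤ |C_B| * ((1 + ‖ξ‖) ^ k * gaussVortexProfile ξ) := by
          rw [mul_assoc]; exact mul_le_mul_of_nonneg_right (le_abs_self _) (by positivity [hGpos ξ])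
      _ ≤ |C_B| * Bk := mul_le_mul_of_nonneg_left (hBk ξ) (abs_nonneg _)
  have hwBi : Integrable wB := by
    refine integrable_of_le_one_add_norm_pow_mul_gauss hwBc (A := |C_B|) (N := k) (fun ξ => ?_)
    rw [Real.norm_eq_abs]
    calc |wB ξ| ≤ C_B * (1 + ‖ξ‖) ^ k * gaussVortexProfile ξ := hwBb ξ
      _ ≤ |C_B| * ((1 + ‖ξ‖) ^ k * gaussVortexProfile ξ) := by
          rw [mul_assoc]; exact mul_le_mul_of_nonneg_right (le_abs_self _) (by positivity [hGpos ξ])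
  set b : EuclideanSpace ℝ (Fin 2) → EuclideanSpace ℝ (Fin 2) := biotSavart2D wB with hb
  obtain ⟨V, hV⟩ : ∃ V : ℝ, ∀ ξ, ‖b ξ‖ ≤ V := ⟨_, fun ξ => norm_biotSavart2D_le hwBi hwBabs ξ⟩
  have hV0 : 0 ≤ V := (norm_nonneg _).trans (hV 0)
  have hbm : AEStronglyMeasurable b volume := (stronglyMeasurable_biotSavart2D hwBc.measurable).aestronglyMeasurable
  -- the test function `h = G u²` is of Gaussian class
  set h : EuclideanSpace ℝ (Fin 2) → ℝ := fun η => gaussVortexProfile η * u η ^ 2 with hh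
  have hh1 : ContDiff ℝ 1 h := (contDiff_gaussVortexProfile (n := 1)).mul (hu.pow 2)
  have hu2d : ∀ ξ, HasFDerivAt (fun η => u η ^ 2) ((2 * u ξ) • fderiv ℝ u ξ) ξ := fun ξ => by
    have := (hud ξ).hasFDerivAt.pow 2
    simpa using this
  have hfd_h : ∀ ξ v, fderiv ℝ h ξ v =
      gaussVortexProfile ξ * (2 * u ξ * fderiv ℝ u ξ v) + u ξ ^ 2 * (-(gaussVortexProfile ξ / 2) * ⟪ξ, v⟫) := by
    intro ξ v
    have hprod : HasFDerivAt (fun η => gaussVortexProfile η * u η ^ 2)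
        (gaussVortexProfile ξ • (2 * u ξ) • fderiv ℝ u ξ + u ξ ^ 2 • fderiv ℝ gaussVortexProfile ξ) ξ :=
      (hGd ξ).hasFDerivAt.mul (hu2d ξ)
    rw [show h = fun η => gaussVortexProfile η * u η ^ 2 from rfl, hprod.fderiv]
    simp only [_root_.add_apply, _root_.smul_apply, smul_eq_mul, fderiv_gaussVortexProfile_apply]
  have hhb : ∀ ξ, |h ξ| + ‖fderiv ℝ h ξ‖ ≤ 3 * M ^ 2 * (1 + ‖ξ‖) ^ 1 * gaussVortexProfile ξ := by
    intro ξ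
    have hG := hGpos ξ
    have hu1 := (hM ξ).1
    have hDu := (hM ξ).2
    have hu2 : u ξ ^ 2 ≤ M ^ 2 := by
      rw [← sq_abs (u ξ)]; exact pow_le_pow_left₀ (abs_nonneg _) hu1 2
    have h1 : |h ξ| ≤ M ^ 2 * gaussVortexProfile ξ := by
      rw [hh]; dsimp only
      rw [abs_mul, abs_of_pos hG, abs_of_nonneg (sq_nonneg _)]
      nlinarith
    have h2 : ‖fderiv ℝ h ξ‖ ≤ (2 * M ^ 2 + M ^ 2 / 2 * ‖ξ‖) * gaussVortexProfile ξ := by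
      refine ContinuousLinearMap.opNorm_le_bound _ (by positivity) fun v => ?_
      rw [hfd_h, Real.norm_eq_abs]
      have hA : |gaussVortexProfile ξ * (2 * u ξ * fderiv ℝ u ξ v)| ≤ 2 * M ^ 2 * gaussVortexProfile ξ * ‖v‖ := by
        rw [abs_mul, abs_of_pos hG, abs_mul, abs_mul]
        have hfv : |fderiv ℝ u ξ v| ≤ M * ‖v‖ := by
          calc |fderiv ℝ u ξ v| = ‖fderiv ℝ u ξ v‖ := (Real.norm_eq_abs _).symm
            _ ≤ ‖fderiv ℝ u ξ‖ * ‖v‖ := ContinuousLinearMap.le_opNorm _ _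
            _ ≤ M * ‖v‖ := mul_le_mul_of_nonneg_right hDu (norm_nonneg _)
        have h2' : |(2 : ℝ)| = 2 := abs_of_pos two_pos
        rw [h2']
        have := mul_le_mul hu1 hfv (abs_nonneg _) hM0
        nlinarith [hG.le, norm_nonneg v]
      have hB : |u ξ ^ 2 * (-(gaussVortexProfile ξ / 2) * ⟪ξ, v⟫)| ≤ M ^ 2 / 2 * ‖ξ‖ * gaussVortexProfile ξ * ‖v‖ := by
        rw [abs_mul, abs_mul, abs_of_nonneg (sq_nonneg _), abs_neg, abs_of_pos (by positivity)]
        have hin : |⟪ξ, v⟫| ≤ ‖ξ‖ * ‖v‖ := abs_real_inner_le_norm _ _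
        have := mul_le_mul hu2 hin (abs_nonneg _) (sq_nonneg M)
        nlinarith [hG.le, norm_nonneg v, norm_nonneg ξ]
      calc |gaussVortexProfile ξ * (2 * u ξ * fderiv ℝ u ξ v) + u ξ ^ 2 * (-(gaussVortexProfile ξ / 2) * ⟪ξ, v⟫)|
          ≤ |gaussVortexProfile ξ * (2 * u ξ * fderiv ℝ u ξ v)| + |u ξ ^ 2 * (-(gaussVortexProfile ξ / 2) * ⟪ξ, v⟫)| :=
            abs_add_le _ _
        _ ≤ 2 * M ^ 2 * gaussVortexProfile ξ * ‖v‖ + M ^ 2 / 2 * ‖ξ‖ * gaussVortexProfile ξ * ‖v‖ := add_le_add hA hB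
        _ = (2 * M ^ 2 + M ^ 2 / 2 * ‖ξ‖) * gaussVortexProfile ξ * ‖v‖ := by ring
    rw [pow_one]
    nlinarith [norm_nonneg ξ, hG, sq_nonneg M, mul_nonneg (mul_nonneg (sq_nonneg M) hG.le) (norm_nonneg ξ)]
  -- weak divergence-freeness against `h`
  have hdiv : ∫ ξ, ⟪b ξ, gradient h ξ⟫ = 0 :=
    integral_inner_biotSavart2D_gradient_eq_zero_of_gaussClass 1 (3 * M ^ 2) (|C_B| * Bk) wB h hwBc hwBi hwBabs hh1 hhb
  -- the pointwise identity
  have hpt : ∀ ξ, (gaussVortexProfile ξ)⁻¹ * ⟪b ξ, gradient (fun η => gaussVortexProfile η * u η) ξ⟫ *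
      (gaussVortexProfile ξ * u ξ) =
      1 / 2 * ⟪b ξ, gradient h ξ⟫ + -(1 / 4) * (gaussVortexProfile ξ * u ξ ^ 2 * ⟪ξ, b ξ⟫) := by
    intro ξ
    rw [inner_gradient_right, inner_gradient_right]
    simp only [RCLike.conj_to_real]
    rw [hfd_h ξ (b ξ), fderiv_fun_mul (hGd ξ) (hud ξ)]
    simp only [_root_.add_apply, _root_.smul_apply, smul_eq_mul, fderiv_gaussVortexProfile_apply]
    field_simp
    ring
  -- integrability of the two pieces
  have hint1 : Integrable fun ξ => ⟪b ξ, gradient h ξ⟫ := by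
    have hmeas : AEStronglyMeasurable (fun ξ => ⟪b ξ, gradient h ξ⟫) volume :=
      hbm.inner (continuous_gradient_of_contDiff hh1).aestronglyMeasurable
    refine Integrable.mono' ((integrable_one_add_norm_pow_mul_gaussVortexProfile 1).const_mul (V * (3 * M ^ 2))) hmeas
      (Eventually.of_forall fun ξ => ?_)
    rw [Real.norm_eq_abs]
    calc |⟪b ξ, gradient h ξ⟫| ≤ ‖b ξ‖ * ‖gradient h ξ‖ := abs_real_inner_le_norm _ _
      _ ≤ V * (3 * M ^ 2 * (1 + ‖ξ‖) ^ 1 * gaussVortexProfile ξ) := by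
          refine mul_le_mul (hV ξ) ?_ (norm_nonneg _) hV0
          rw [gradient, LinearIsometryEquiv.norm_map]
          exact le_trans (le_add_of_nonneg_left (abs_nonneg _)) (hhb ξ)
      _ = V * (3 * M ^ 2) * ((1 + ‖ξ‖) ^ 1 * gaussVortexProfile ξ) := by ring
  have hint2 : Integrable fun ξ => gaussVortexProfile ξ * u ξ ^ 2 * ⟪ξ, b ξ⟫ := by
    have hmeas : AEStronglyMeasurable (fun ξ => gaussVortexProfile ξ * u ξ ^ 2 * ⟪ξ, b ξ⟫) volume :=
      (((contDiff_gaussVortexProfile (n := 0)).continuous.mul (hu.continuous.pow 2)).aestronglyMeasurable).mul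
        (continuous_id.aestronglyMeasurable.inner hbm)
    refine Integrable.mono' ((integrable_one_add_norm_pow_mul_gaussVortexProfile 1).const_mul (M ^ 2 * V)) hmeas
      (Eventually.of_forall fun ξ => ?_)
    have hG := hGpos ξ
    rw [Real.norm_eq_abs, abs_mul, abs_mul, abs_of_pos hG, abs_of_nonneg (sq_nonneg _), pow_one]
    have hu2 : u ξ ^ 2 ≤ M ^ 2 := by
      rw [← sq_abs (u ξ)]; exact pow_le_pow_left₀ (abs_nonneg _) (hM ξ).1 2
    have hin : |⟪ξ, b ξ⟫| ≤ ‖ξ‖ * V :=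
      (abs_real_inner_le_norm _ _).trans (mul_le_mul_of_nonneg_left (hV ξ) (norm_nonneg _))
    have := mul_le_mul hu2 hin (abs_nonneg _) (sq_nonneg M)
    nlinarith [hG.le, norm_nonneg ξ, mul_nonneg (mul_nonneg (sq_nonneg M) hV0) hG.le]
  -- integrate
  calc ∫ ξ, (gaussVortexProfile ξ)⁻¹ * ⟪b ξ, gradient (fun η => gaussVortexProfile η * u η) ξ⟫ *
          (gaussVortexProfile ξ * u ξ)
      = ∫ ξ, (1 / 2 * ⟪b ξ, gradient h ξ⟫ + -(1 / 4) * (gaussVortexProfile ξ * u ξ ^ 2 * ⟪ξ, b ξ⟫)) :=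
        integral_congr_ae (Eventually.of_forall hpt)
    _ = 1 / 2 * (∫ ξ, ⟪b ξ, gradient h ξ⟫) + -(1 / 4) * ∫ ξ, gaussVortexProfile ξ * u ξ ^ 2 * ⟪ξ, b ξ⟫ := by
        rw [integral_add (hint1.const_mul _) (hint2.const_mul _), integral_const_mul, integral_const_mul]
    _ = -(1 / 4) * ∫ ξ, gaussVortexProfile ξ * u ξ ^ 2 * ⟪ξ, b ξ⟫ := by rw [hdiv]; ring

end Summit.AnomalousDissipation.AnomalousDissipation.Theorems.MarginalStabilityChainStretchedVortexRows

end
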